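import Literature.AlgebraicGeometry.Hu2025.Statements.S03Pluecker.R102aOrders
import Literature.AlgebraicGeometry.Hu2025.Proofs.S03Pluecker.Count
import HarnessLib

/-!
# Hu 2025 §3.4–§3.5 — DISCHARGE of row 102's order claims: `C19L143_holds` («𝓕_m = {F̄_1 <_℘ ⋯ <_℘ F̄_Υ}»: `<_℘` is a strict total order on
# `𝕀^lt_{3,n}`) (row 102a, typer res-type-009; `C20L34` — the coincidence with the §3.5 bullet order, typed literally in R102a rev 2 — is NOT proved here)

**HONEST FRAMING (D-0012/D-0089).** Theorems about OUR typed transcriptions (`LexLT` = «left-most difference» order typed SORT-FREE as «the least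
element of the symmetric difference lies in the left set», `mRank`, `WpLT`, `SummaryLT`); the preprint [Hu2025] stays «under review». §1 proves that
`LexLT` is irreflexive, transitive and trichotomous on ALL finite subsets of a linear order (so in particular on the equal-cardinality subsets Def 3.11
speaks of); §2 lifts this to `<_℘` on `𝕀^lt_{3,n}` (an increasing triple is determined by `u ∖ m` and `u ∩ m`); §3 the coincidence. AI proof, weaker
than expert review; nothing here is progress on resolution of singularities.
-/

noncomputable section

namespace Literature.AlgebraicGeometry.Hu2025.Statements.S03Pluecker

open MvPolynomial

universe v

/-! ## §1 `LexLT` is a strict total order on the finite subsets of a linear order -/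

section Lex

variable {K : Type v} [LinearOrder K]

/-- Irreflexivity.
[cite: Hu2025, Def. 3.13 / 3.14 (C19L143, C20L34), p.42 l.3–18; §2e.2 p.25 l.42–45; §3e p.43 l.18–22 (unrefereed preprint arXiv:2507.21400v1 under adjudication, D-0012/D-0089
— kernel support on OUR typed carriers of row 102; nothing of the source asserted)] -/
theorem LexLT.irrefl (η : Finset K) : ¬ LexLT η η := by
  rintro ⟨h, -⟩
  simp [symmDiff_self] at h

/-- Unfolding: `η <_lex ζ` iff some `a ∈ η ∖ ζ` lies below every element of `ζ ∖ η`.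
[cite: Hu2025, Def. 3.13 / 3.14 (C19L143, C20L34), p.42 l.3–18; §2e.2 p.25 l.42–45; §3e p.43 l.18–22 (unrefereed preprint arXiv:2507.21400v1 under adjudication, D-0012/D-0089
— kernel support on OUR typed carriers of row 102; nothing of the source asserted)] -/
theorem lexLT_iff (η ζ : Finset K) : LexLT η ζ ↔ ∃ a ∈ η, a ∉ ζ ∧ ∀ b ∈ ζ, b ∉ η → a < b := by
  classical
  constructor
  · rintro ⟨hne, hmin⟩
    set a := (symmDiff η ζ).min' hne with ha
    have hamem : a ∈ symmDiff η ζ := Finset.min'_mem _ _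
    rw [Finset.mem_symmDiff] at hamem
    have haζ : a ∉ ζ := by
      rcases hamem with ⟨-, h⟩ | ⟨-, h⟩
      · exact h
      · exact absurd hmin h
    refine ⟨a, hmin, haζ, fun b hb hbη => ?_⟩
    have hbmem : b ∈ symmDiff η ζ := Finset.mem_symmDiff.mpr (Or.inr ⟨hb, hbη⟩)
    have hle : a ≤ b := Finset.min'_le _ _ hbmem
    exact lt_of_le_of_ne hle (fun h => hbη (h ▸ hmin))
  · rintro ⟨a, haη, haζ, hlt⟩
    have hamem : a ∈ symmDiff η ζ := Finset.mem_symmDiff.mpr (Or.inl ⟨haη, haζ⟩)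
    have hne : (symmDiff η ζ).Nonempty := ⟨a, hamem⟩
    refine ⟨hne, ?_⟩
    by_contra hmin
    set c := (symmDiff η ζ).min' hne with hc
    have hcmem : c ∈ symmDiff η ζ := Finset.min'_mem _ _
    rw [Finset.mem_symmDiff] at hcmem
    rcases hcmem with ⟨h, -⟩ | ⟨hcζ, hcη⟩
    · exact hmin h
    · have h1 : a < c := hlt c hcζ hcη
      have h2 : c ≤ a := Finset.min'_le _ _ hamem
      exact absurd (lt_of_lt_of_le h1 h2) (lt_irrefl _)

/-- Trichotomy: distinct finite sets are `LexLT`-comparable.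
[cite: Hu2025, Def. 3.13 / 3.14 (C19L143, C20L34), p.42 l.3–18; §2e.2 p.25 l.42–45; §3e p.43 l.18–22 (unrefereed preprint arXiv:2507.21400v1 under adjudication, D-0012/D-0089
— kernel support on OUR typed carriers of row 102; nothing of the source asserted)] -/
theorem LexLT.trichotomous (η ζ : Finset K) : LexLT η ζ ∨ η = ζ ∨ LexLT ζ η := by
  classical
  by_cases h : η = ζ
  · exact Or.inr (Or.inl h)
  have hne : (symmDiff η ζ).Nonempty := by
    rw [Finset.nonempty_iff_ne_empty, Ne, Finset.symmDiff_eq_empty]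
    exact h
  have hmem : (symmDiff η ζ).min' hne ∈ symmDiff η ζ := Finset.min'_mem _ _
  rw [Finset.mem_symmDiff] at hmem
  rcases hmem with ⟨hη, -⟩ | ⟨hζ, -⟩
  · exact Or.inl ⟨hne, hη⟩
  · right; right
    have hne' : (symmDiff ζ η).Nonempty := by rwa [symmDiff_comm]
    refine ⟨hne', ?_⟩
    have : (symmDiff ζ η).min' hne' = (symmDiff η ζ).min' hne := by
      congr 1; exact symmDiff_comm _ _
    rw [this]; exact hζ

/-- Asymmetry.
[cite: Hu2025, Def. 3.13 / 3.14 (C19L143, C20L34), p.42 l.3–18; §2e.2 p.25 l.42–45; §3e p.43 l.18–22 (unrefereed preprint arXiv:2507.21400v1 under adjudication, D-0012/D-0089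
— kernel support on OUR typed carriers of row 102; nothing of the source asserted)] -/
theorem LexLT.asymm {η ζ : Finset K} (h : LexLT η ζ) : ¬ LexLT ζ η := by
  classical
  rw [lexLT_iff] at h ⊢
  rintro ⟨b, hbζ, hbη, hb⟩
  obtain ⟨a, haη, haζ, ha⟩ := h
  exact lt_irrefl a ((ha b hbζ hbη).trans (hb a haη haζ))

/-- Transitivity.
[cite: Hu2025, Def. 3.13 / 3.14 (C19L143, C20L34), p.42 l.3–18; §2e.2 p.25 l.42–45; §3e p.43 l.18–22 (unrefereed preprint arXiv:2507.21400v1 under adjudication, D-0012/D-0089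
— kernel support on OUR typed carriers of row 102; nothing of the source asserted)] -/
theorem LexLT.trans {η ζ θ : Finset K} (h₁ : LexLT η ζ) (h₂ : LexLT ζ θ) : LexLT η θ := by
  classical
  rw [lexLT_iff] at h₁ h₂ ⊢
  obtain ⟨a, haη, haζ, ha⟩ := h₁
  obtain ⟨b, hbζ, hbθ, hb⟩ := h₂
  rcases lt_trichotomy a b with hab | hab | hab
  · -- `a < b`: `a` is the witness
    have haθ : a ∉ θ := fun haθ => lt_irrefl a ((hb a haθ haζ).trans' hab |>.trans_le le_rfl)
    refine ⟨a, haη, haθ, fun c hcθ hcη => ?_⟩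
    by_cases hcζ : c ∈ ζ
    · exact ha c hcζ hcη
    · exact hab.trans (hb c hcθ hcζ)
  · exact absurd hbζ (hab ▸ haζ)
  · -- `b < a`: `b` is the witness
    have hbη : b ∈ η := by
      by_contra hbη
      exact lt_irrefl b ((ha b hbζ hbη).trans' hab |>.trans_le le_rfl)
    refine ⟨b, hbη, hbθ, fun c hcθ hcη => ?_⟩
    by_cases hcζ : c ∈ ζ
    · exact hab.trans (ha c hcζ hcη)
    · exact hb c hcθ hcζ

end Lex

/-! ## §2 `<_℘` on `𝕀^lt_{3,n}` -/

variable {n : ℕ}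

/-- An increasing triple is recovered from `u ∖ m` and `u ∩ m` (`u = (u ∖ m) ∪ (u ∩ m)` and `triSet` is injective on `𝕀_{3,n}`).
[cite: Hu2025, Def. 3.13 / 3.14 (C19L143, C20L34), p.42 l.3–18; §2e.2 p.25 l.42–45; §3e p.43 l.18–22 (unrefereed preprint arXiv:2507.21400v1 under adjudication, D-0012/D-0089
— kernel support on OUR typed carriers of row 102; nothing of the source asserted)] -/
theorem eq_of_sdiff_eq_of_inter_eq {u v : ℕ × ℕ × ℕ} (hu : u ∈ plIndexSet n) (hv : v ∈ plIndexSet n)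
    (h1 : triSet u \ mSet = triSet v \ mSet) (h2 : mSet ∩ triSet u = mSet ∩ triSet v) : u = v := by
  apply triSet_injOn hu hv
  rw [← Finset.sdiff_union_inter (triSet u) mSet, ← Finset.sdiff_union_inter (triSet v) mSet, h1, Finset.inter_comm, h2,
    Finset.inter_comm]

/-- **`C19L143` HOLDS** as typed: `<_℘` (Def 3.13) is a strict total order on `𝕀^lt_{3,n}`.
[cite: Hu2025, Def. 3.13 / 3.14 (C19L143, C20L34), p.42 l.3–18; §2e.2 p.25 l.42–45; §3e p.43 l.18–22 (unrefereed preprint arXiv:2507.21400v1 under adjudication, D-0012/D-0089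
— kernel support on OUR typed carriers of row 102; nothing of the source asserted)] -/
theorem C19L143_holds : C19L143 n := by
  classical
  refine { trichotomous := ?_, irrefl := ?_, trans := ?_ }
  · rintro ⟨⟨u, hu⟩, hul⟩ ⟨⟨v, hv⟩, hvl⟩ hab hba
    simp only [Subtype.mk.injEq]
    unfold WpLT at hab hba
    rcases lt_trichotomy (mRank u) (mRank v) with h | h | h
    · exact absurd (Or.inl h) hab
    · rcases LexLT.trichotomous (triSet u \ mSet) (triSet v \ mSet) with h1 | h1 | h1
      · exact absurd (Or.inr (Or.inl ⟨h, h1⟩)) hab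
      · rcases LexLT.trichotomous (mSet ∩ triSet u) (mSet ∩ triSet v) with h2 | h2 | h2
        · exact absurd (Or.inr (Or.inr ⟨h, h1, h2⟩)) hab
        · exact eq_of_sdiff_eq_of_inter_eq hu hv h1 h2
        · exact absurd (Or.inr (Or.inr ⟨h.symm, h1.symm, h2⟩)) hba
      · exact absurd (Or.inr (Or.inl ⟨h.symm, h1⟩)) hba
    · exact absurd (Or.inl h) hba
  · rintro ⟨⟨u, hu⟩, hul⟩ h
    unfold WpLT at h
    rcases h with h | ⟨-, h⟩ | ⟨-, -, h⟩
    · exact lt_irrefl _ h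
    · exact LexLT.irrefl _ h
    · exact LexLT.irrefl _ h
  · rintro ⟨⟨u, hu⟩, hul⟩ ⟨⟨v, hv⟩, hvl⟩ ⟨⟨w, hw⟩, hwl⟩ h₁ h₂
    unfold WpLT at h₁ h₂ ⊢
    simp only at h₁ h₂ ⊢
    rcases h₁ with h₁ | ⟨e₁, l₁⟩ | ⟨e₁, s₁, l₁⟩ <;> rcases h₂ with h₂ | ⟨e₂, l₂⟩ | ⟨e₂, s₂, l₂⟩
    · exact Or.inl (h₁.trans h₂)
    · exact Or.inl (h₁.trans_eq e₂)
    · exact Or.inl (h₁.trans_eq e₂)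
    · exact Or.inl (e₁.trans_lt h₂)
    · exact Or.inr (Or.inl ⟨e₁.trans e₂, l₁.trans l₂⟩)
    · exact Or.inr (Or.inl ⟨e₁.trans e₂, s₂ ▸ l₁⟩)
    · exact Or.inl (e₁.trans_lt h₂)
    · exact Or.inr (Or.inl ⟨e₁.trans e₂, s₁ ▸ l₂⟩)
    · exact Or.inr (Or.inr ⟨e₁.trans e₂, s₁.trans s₂, l₁.trans l₂⟩)

/-- **Def 3.14's `<` is a strict total order on ALL the Plücker variables `x_u`, `u ∈ 𝕀_{3,n} ∖ m`** (Def 3.14 «when comparing two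
Plücker variables … we exclusively use <_℘», p.42 l.16–18; the typed relation `Def3_14` on `plVar n`): the three clauses of Def 3.13
are trichotomous because `u` is determined by `(u ∖ m, u ∩ m)`. Same argument as `C19L143_holds`, without the restriction to `𝕀^lt`.
[cite: Hu2025, Def. 3.13 / 3.14, p.42 l.3–18 (unrefereed preprint arXiv:2507.21400v1 under adjudication, D-0012/D-0089
— kernel support on OUR typed carriers of row 102; nothing of the source asserted)] -/
theorem Def3_14_isStrictTotalOrder : IsStrictTotalOrder (plVar n) Def3_14 := by
  classical
  refine { trichotomous := ?_, irrefl := ?_, trans := ?_ }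
  · rintro ⟨u, hu⟩ ⟨v, hv⟩ hab hba
    have hu' : u ∈ plIndexSet n := (Finset.mem_erase.mp hu).2
    have hv' : v ∈ plIndexSet n := (Finset.mem_erase.mp hv).2
    simp only [Subtype.mk.injEq]
    unfold Def3_14 WpLT at hab hba
    rcases lt_trichotomy (mRank u) (mRank v) with h | h | h
    · exact absurd (Or.inl h) hab
    · rcases LexLT.trichotomous (triSet u \ mSet) (triSet v \ mSet) with h1 | h1 | h1
      · exact absurd (Or.inr (Or.inl ⟨h, h1⟩)) hab
      · rcases LexLT.trichotomous (mSet ∩ triSet u) (mSet ∩ triSet v) with h2 | h2 | h2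
        · exact absurd (Or.inr (Or.inr ⟨h, h1, h2⟩)) hab
        · exact eq_of_sdiff_eq_of_inter_eq hu' hv' h1 h2
        · exact absurd (Or.inr (Or.inr ⟨h.symm, h1.symm, h2⟩)) hba
      · exact absurd (Or.inr (Or.inl ⟨h.symm, h1⟩)) hba
    · exact absurd (Or.inl h) hba
  · rintro ⟨u, hu⟩ h
    unfold Def3_14 WpLT at h
    rcases h with h | ⟨-, h⟩ | ⟨-, -, h⟩
    · exact lt_irrefl _ h
    · exact LexLT.irrefl _ h
    · exact LexLT.irrefl _ h
  · rintro ⟨u, hu⟩ ⟨v, hv⟩ ⟨w, hw⟩ h₁ h₂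
    unfold Def3_14 WpLT at h₁ h₂ ⊢
    simp only at h₁ h₂ ⊢
    rcases h₁ with h₁ | ⟨e₁, l₁⟩ | ⟨e₁, s₁, l₁⟩ <;> rcases h₂ with h₂ | ⟨e₂, l₂⟩ | ⟨e₂, s₂, l₂⟩
    · exact Or.inl (h₁.trans h₂)
    · exact Or.inl (h₁.trans_eq e₂)
    · exact Or.inl (h₁.trans_eq e₂)
    · exact Or.inl (e₁.trans_lt h₂)
    · exact Or.inr (Or.inl ⟨e₁.trans e₂, l₁.trans l₂⟩)
    · exact Or.inr (Or.inl ⟨e₁.trans e₂, s₂ ▸ l₁⟩)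
    · exact Or.inl (e₁.trans_lt h₂)
    · exact Or.inr (Or.inl ⟨e₁.trans e₂, s₁ ▸ l₂⟩)
    · exact Or.inr (Or.inr ⟨e₁.trans e₂, s₁.trans s₂, l₁.trans l₂⟩)

end Literature.AlgebraicGeometry.Hu2025.Statements.S03Pluecker

end
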